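import Mathlib
import HarnessLib
import Summits.NavierStokesRegularity.NavierStokesRegularity.Theorems.PoloidalWindowDoorLrcModEntireThreadSpaceTimePin

/-!
# Route `PoloidalWindowDoor`, item `LrcModEntire` (stmt-NavierStokesRegularity-20428) / crux K2 (stmt-19708) —
# the THREADED HOT SPOT: 2×2 minors of the corrected space-time form

LEAD of item 20428 ns-poloidal-K2-p3 g10 (`--supports stmt-NavierStokesRegularity-20428 --as helper`).
By `threadSpaceTimeHessianPin` / `spaceTime_correctedForm_nonpos` the corrected space-time form
`B(U,U') = σ D²_{(t,x)}v₂(−1,0)[U,U'] − (3/4)|v₂(−1,0)| τ_U τ_{U'}` is symmetric and non-positive at the hot spot.  A non-positive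
symmetric form satisfies the Cauchy–Schwarz inequality `B(u,w)² ≤ B(u,u)·B(w,w)` (`form_sq_le_mul_of_nonpos`, abstract); applied to
`u = (1,0)` and `w = (0,w)` it bounds the space-time MIXED second derivatives of `v₂` at the hot spot by the geometric mean of the
time-acceleration deficit and the spatial curvature: `(∂ₜ∂_w v₂)² ≤ (∂ₜ²v₂ − (3/4)v₂)·(∂_w²v₂)` (`threadSpaceTimeMinor`, sign-free).
WHAT THIS IS NOT: not the thick stub, not a claim about Navier–Stokes regularity — calculus at a hot spot (bears_on LADDER-NS N0,
rung N0-LocalTubeDoorPoloidal). [folklore]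
-/

noncomputable section

-- the summit and its single sub-problem share the name (CONVENTIONS §1), as in every Theorems file
set_option linter.dupNamespace false

namespace Summit.NavierStokesRegularity.NavierStokesRegularity.Theorems.PoloidalWindowDoorLrcModEntireThreadSpaceTimeMinors

open MeasureTheory Set Function Filter Topology
open scoped RealInnerProductSpace InnerProductSpace
open Literature.Analysis Literature.Analysis.FluidPDE Literature.Analysis.UnboundedOperators
open Summit.NavierStokesRegularity.NavierStokesRegularity.Theorems.LocalSineTubeDoorProfileAlignedWindowRigidityAncient
open Summit.NavierStokesRegularity.NavierStokesRegularity.Theorems.PoloidalWindowDoorLrcModEntireThreadSpaceTimePin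

/-- **Cauchy–Schwarz for a non-positive symmetric form** (abstract): `B` additive and homogeneous in the first slot, symmetric and
`B u u ≤ 0` for all `u` ⇒ `(B u w)² ≤ B u u · B w w`. [folklore] -/
theorem form_sq_le_mul_of_nonpos {F : Type*} [AddCommGroup F] [Module ℝ F] (B : F → F → ℝ)
    (hadd : ∀ u u' w : F, B (u + u') w = B u w + B u' w) (hsmul : ∀ (c : ℝ) (u w : F), B (c • u) w = c * B u w)
    (hsymm : ∀ u w : F, B u w = B w u) (hsd : ∀ u : F, B u u ≤ 0) (u w : F) :
    (B u w) ^ 2 ≤ B u u * B w w := by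
  set a : ℝ := B u w with ha
  set b : ℝ := B w w with hb
  set c : ℝ := B u u with hc
  have hb0 : b ≤ 0 := hsd w
  have hc0 : c ≤ 0 := hsd u
  have key : ∀ t : ℝ, c + 2 * t * a + t ^ 2 * b ≤ 0 := by
    intro t
    have h := hsd (u + t • w)
    have hexp : B (u + t • w) (u + t • w) = B u u + t * B u w + t * B u w + t ^ 2 * B w w := by
      rw [hadd, hsmul, hsymm u (u + t • w), hsymm w (u + t • w), hadd, hsmul, hadd, hsmul, hsymm w u]; ring
    rw [hexp] at h
    have : B u u + t * B u w + t * B u w + t ^ 2 * B w w = c + 2 * t * a + t ^ 2 * b := by rw [ha, hb, hc]; ring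
    linarith [h, this]
  rcases eq_or_lt_of_le hb0 with hbz | hbneg
  · -- `b = 0`: then `c + 2ta ≤ 0` for all `t` forces `a = 0`
    have ha0 : a = 0 := by
      by_contra hne
      have ht := key ((1 - c) / (2 * a))
      rw [hbz, mul_zero, add_zero] at ht
      have : 2 * ((1 - c) / (2 * a)) * a = 1 - c := by field_simp
      linarith
    rw [ha0, hbz]; simp
  · -- `b < 0`: evaluate at `t = -a/b`
    have ht := key (-a / b)
    have hid : c + 2 * (-a / b) * a + (-a / b) ^ 2 * b = c - a ^ 2 / b := by
      field_simp; ring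
    rw [hid] at ht
    -- `c - a²/b ≤ 0` with `b < 0` ⇒ `c b - a² ≥ 0`
    have hbne : b ≠ 0 := hbneg.ne
    have h1 : a ^ 2 / b * b = a ^ 2 := div_mul_cancel₀ _ hbne
    nlinarith [mul_le_mul_of_nonpos_right ht hbneg.le, h1]

section Class

variable {v : ℝ → EuclideanSpace ℝ (Fin 3) → EuclideanSpace ℝ (Fin 3)} {C : ℝ}

/-- **SPACE-TIME MINOR at the hot spot** (sign-free).  For a profile of the class whose scale-invariant vertical size peaks at `(−1,0)`
with `v₂(−1,0) ≠ 0`, and every spatial direction `w`: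
`(D²_{(t,x)}v₂(−1,0)[(1,0),(0,w)])² ≤ (D²_{(t,x)}v₂(−1,0)[(1,0),(1,0)] − (3/4) v₂(−1,0)) · D²_{(t,x)}v₂(−1,0)[(0,w),(0,w)]`,
i.e. `(∂ₜ∂_w v₂)² ≤ (∂ₜ²v₂ − ¾v₂)(∂_w²v₂)` at the hot spot. [folklore] -/
theorem threadSpaceTimeMinor (hrate : HasTypeITimeDecay C v) (hcont : ContinuousOn (uncurry v) (Iio (0 : ℝ) ×ˢ univ))
    (hmild : ∀ s t : ℝ, s < t → t < 0 → ∀ x, v t x = heatExtension (v s) (t - s) x - oseenDuhamel 1 s v v t x)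
    (hne : v (-1) 0 2 ≠ 0) (hhot : ∀ t < 0, ∀ x, Real.sqrt (-t) * |v t x 2| ≤ |v (-1) 0 2|) (w : EuclideanSpace ℝ (Fin 3)) :
    (iteratedFDeriv ℝ 2 (fun p : ℝ × EuclideanSpace ℝ (Fin 3) => v p.1 p.2 2) ((-1 : ℝ), (0 : EuclideanSpace ℝ (Fin 3)))
        ![((1 : ℝ), (0 : EuclideanSpace ℝ (Fin 3))), ((0 : ℝ), w)]) ^ 2 ≤
      (iteratedFDeriv ℝ 2 (fun p : ℝ × EuclideanSpace ℝ (Fin 3) => v p.1 p.2 2) ((-1 : ℝ), (0 : EuclideanSpace ℝ (Fin 3)))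
          ![((1 : ℝ), (0 : EuclideanSpace ℝ (Fin 3))), ((1 : ℝ), (0 : EuclideanSpace ℝ (Fin 3)))] - 3 / 4 * v (-1) 0 2) *
        iteratedFDeriv ℝ 2 (fun p : ℝ × EuclideanSpace ℝ (Fin 3) => v p.1 p.2 2) ((-1 : ℝ), (0 : EuclideanSpace ℝ (Fin 3)))
          ![((0 : ℝ), w), ((0 : ℝ), w)] := by
  have hnear := spaceTime_contDiffAt hrate hcont hmild (P := ((-1 : ℝ), (0 : EuclideanSpace ℝ (Fin 3)))) (by norm_num)
  obtain ⟨σ, hσabs, hσa⟩ : ∃ σ : ℝ, |σ| = 1 ∧ σ * v (-1) 0 2 = |v (-1) 0 2| := by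
    rcases lt_or_gt_of_ne hne with h | h
    · exact ⟨-1, by simp, by rw [abs_of_neg h]; ring⟩
    · exact ⟨1, by simp, by rw [abs_of_pos h]; ring⟩
  have hσ2 : σ ^ 2 = 1 := by
    have h := congrArg (fun r : ℝ => r ^ 2) hσabs
    simpa only [sq_abs, one_pow] using h
  have hQ := spaceTime_correctedForm_nonpos hrate hcont hmild hne hhot hσa
  set G : ℝ × EuclideanSpace ℝ (Fin 3) → ℝ := fun p => v p.1 p.2 2 with hG
  set P : ℝ × EuclideanSpace ℝ (Fin 3) := ((-1 : ℝ), (0 : EuclideanSpace ℝ (Fin 3))) with hP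
  have hGP : ContDiffAt ℝ 2 G P := hnear.self_of_nhds
  have hsymmG : IsSymmSndFDerivAt ℝ G P := hGP.isSymmSndFDerivAt (by simp)
  have hq : ∀ u u' : ℝ × EuclideanSpace ℝ (Fin 3), iteratedFDeriv ℝ 2 G P ![u, u'] = fderiv ℝ (fderiv ℝ G) P u u' := by
    intro u u'; rw [iteratedFDeriv_two_apply]; simp
  set B : (ℝ × EuclideanSpace ℝ (Fin 3)) → (ℝ × EuclideanSpace ℝ (Fin 3)) → ℝ :=
    fun u u' => σ * fderiv ℝ (fderiv ℝ G) P u u' - 3 / 4 * |v (-1) 0 2| * (u.1 * u'.1) with hB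
  have hadd : ∀ u u' w : ℝ × EuclideanSpace ℝ (Fin 3), B (u + u') w = B u w + B u' w := fun u u' w => by
    simp only [hB, map_add, add_apply, Prod.fst_add]; ring
  have hsmul : ∀ (c : ℝ) (u w : ℝ × EuclideanSpace ℝ (Fin 3)), B (c • u) w = c * B u w := fun c u w => by
    simp only [hB, map_smul, FunLike.coe_smul, Pi.smul_apply, smul_eq_mul, Prod.smul_fst]; ring
  have hsymm : ∀ u w : ℝ × EuclideanSpace ℝ (Fin 3), B u w = B w u := fun u w => by
    simp only [hB, hsymmG u w]; ring
  have hsd : ∀ u : ℝ × EuclideanSpace ℝ (Fin 3), B u u ≤ 0 := fun u => by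
    have h := hQ u
    rw [hq] at h
    simp only [hB]; nlinarith [h]
  have hCS := form_sq_le_mul_of_nonpos B hadd hsmul hsymm hsd ((1 : ℝ), (0 : EuclideanSpace ℝ (Fin 3))) ((0 : ℝ), w)
  simp only [hB, mul_zero, mul_one, sub_zero] at hCS
  rw [hq, hq, hq]
  -- hCS : (σ M)² ≤ (σ T − 3/4 |V|) (σ S); with |V| = σ V and σ² = 1 this is the claim
  rw [← hσa] at hCS
  set M := fderiv ℝ (fderiv ℝ G) P ((1 : ℝ), (0 : EuclideanSpace ℝ (Fin 3))) ((0 : ℝ), w)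
  set T := fderiv ℝ (fderiv ℝ G) P ((1 : ℝ), (0 : EuclideanSpace ℝ (Fin 3))) ((1 : ℝ), (0 : EuclideanSpace ℝ (Fin 3)))
  set S := fderiv ℝ (fderiv ℝ G) P ((0 : ℝ), w) ((0 : ℝ), w)
  have e1 : (σ * M) ^ 2 = M ^ 2 := by rw [mul_pow, hσ2, one_mul]
  have e2 : (σ * T - 3 / 4 * (σ * v (-1) 0 2)) * (σ * S) = σ ^ 2 * ((T - 3 / 4 * v (-1) 0 2) * S) := by ring
  rw [e1, e2, hσ2, one_mul] at hCS
  exact hCS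

end Class

end Summit.NavierStokesRegularity.NavierStokesRegularity.Theorems.PoloidalWindowDoorLrcModEntireThreadSpaceTimeMinors
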